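import Summits.BirchSwinnertonDyer.BirchSwinnertonDyer.Theses.KolyvaginRankRigidityAtTwo
import Summits.BirchSwinnertonDyer.BirchSwinnertonDyer.Theorems.KolyvaginRankRigidityAtTwoKolyvaginSwapAssembly
import Summits.BirchSwinnertonDyer.BirchSwinnertonDyer.Theorems.KolyvaginRankRigidityAtTwoShedSeedPrimeShapedAtTwo
import HarnessLib

/-!
# LINE 17 «kolyvagin_swap» v8.8 — the composition BY TREE NAME (pen bsd-idea-1 g22, 2026-08-30)

Crux U1 = `stmt-BirchSwinnertonDyer-28083`
  (`Summit.BirchSwinnertonDyer.BirchSwinnertonDyer.Theses.KolyvaginRankRigidityAtTwo.KolyvaginBoundedDefectAtTwo`).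

v8.8 = v8.7 (sha16 d3b9a0bb83a1ed01, 1 515 l., 2 sorries) with EVERYTHING below the two inputs replaced by the tree:
* S0ʳ is the tree constant `…Theorems.KolyvaginAtTwo.KolyvaginSwap.KolyvaginRoomSeedAtTwo`
  (`Theorems/KolyvaginRankRigidityAtTwoKolyvaginSwapDefs.lean` l.56, `@[conjecture]`, p736848; critic idea-crit-5 #355d:
  v8.7's local def is `Iff.rfl`-equal to it);
* SWα⁗ `ShedSeedPrimeShapedAtTwo` is FED BY NAME from the tree theorem
  `…KolyvaginSwap.shedSeedPrimeShapedAtTwo_of_frobeniusCongruence : P372 → ShedSeedPrimeShapedAtTwo`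
  (`Theorems/KolyvaginRankRigidityAtTwoShedSeedPrimeShapedAtTwo.lean` l.94, p738438);
* the composition is the tree theorem
  `…KolyvaginSwap.kolyvaginBoundedDefectAtTwo_of_roomSeed_of_shedSeed : S0ʳ → SWα⁗ → P372 → U1`
  (`Theorems/KolyvaginRankRigidityAtTwoKolyvaginSwapAssembly.lean` l.321, width seat krr2-p2, landed 2026-08-30T01:37Z;
  LD / START / Zζ / Q2 / VG / sign law / EV are fed inside it by name).

Registered stubs (sorries EXACTLY 2 — the line's two INPUTS, nothing else):
* `stub_roomSeedAtTwo`     : S0ʳ = `KolyvaginRoomSeedAtTwo` (BEYOND PRINT: Kolyvagin non-vanishing WITH ROOM at `p = 2`; every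
                             `_false_without_` obstruction of `Cruxes/KolyvaginBoundedDefectAtTwo/Disproof.lean` is honoured because the
                             line uses Kolyvagin's conjecture at 2 exactly here and nowhere else);
* `stub_heegnerCongruence` : P372 = `Literature.NumberTheory.EllipticCurves.GrossLMS1991.prop37_2_frobeniusCongruence`
                             (PRINT: Gross 1991 Prop. 3.7 (2) / Nekovář 2007 Prop. 4.9; shared item stmt-BirchSwinnertonDyer-23091;
                             its Eichler–Shimura step is the documented wall — a named fact, used as a hypothesis by the tree too).

So after v8.8 the kernel distance from U1 to its inputs is ZERO: `U1 ⟸ {S0ʳ, P372}` is a three-line term over tree names.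
HONEST FRAMING: U1 is NOT proved (two sorries = the two inputs); S0ʳ is OPEN (a form of Kolyvagin's conjecture at 2); BSD is NOT proved;
no rung moves.  W-79: the pen NEVER runs `ledger skeleton check … --crux stmt-BirchSwinnertonDyer-28083` (registration is the LEAD's,
cruxlead-28083); publish path `ledger crux write stmt-BirchSwinnertonDyer-28083 Lines/kolyvagin_swap_v88.lean --file …` + card + evidence.
-/

namespace Summit.BirchSwinnertonDyer.BirchSwinnertonDyer.Cruxes.KolyvaginBoundedDefectAtTwo.KolyvaginSwap

/-- **stub (XL, beyond print) — THE INPUT** S0ʳ: Kolyvagin non-vanishing WITH ROOM at `p = 2`, the tree constant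
`KolyvaginSwap.KolyvaginRoomSeedAtTwo` (`@[conjecture]`).  Why it might fail: only with Kolyvagin's conjecture at 2 itself. -/
theorem stub_roomSeedAtTwo :
    Summit.BirchSwinnertonDyer.BirchSwinnertonDyer.Theorems.KolyvaginAtTwo.KolyvaginSwap.KolyvaginRoomSeedAtTwo := by
  sorry

/-- **stub (print fact)** P372: Gross 1991 Prop. 3.7 (2) — the Frobenius congruence `Frob_λ y_n = ε · ȳ_{n/ℓ}` for Heegner points
(shared item stmt-BirchSwinnertonDyer-23091; Literature named fact, Eichler–Shimura wall).  [cite: GrossLMS1991, §3 Prop. 3.7 (2)] -/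
theorem stub_heegnerCongruence :
    Literature.NumberTheory.EllipticCurves.GrossLMS1991.prop37_2_frobeniusCongruence := by
  sorry

/-- **The composition, by tree name: S0ʳ → P372 → U1** (SWα⁗ fed by `shedSeedPrimeShapedAtTwo_of_frobeniusCongruence`). -/
theorem KolyvaginBoundedDefectAtTwo_of
    (hS : Summit.BirchSwinnertonDyer.BirchSwinnertonDyer.Theorems.KolyvaginAtTwo.KolyvaginSwap.KolyvaginRoomSeedAtTwo)
    (h37 : Literature.NumberTheory.EllipticCurves.GrossLMS1991.prop37_2_frobeniusCongruence) :
    Summit.BirchSwinnertonDyer.BirchSwinnertonDyer.Theses.KolyvaginRankRigidityAtTwo.KolyvaginBoundedDefectAtTwo :=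
  Summit.BirchSwinnertonDyer.BirchSwinnertonDyer.Theorems.KolyvaginAtTwo.KolyvaginSwap.kolyvaginBoundedDefectAtTwo_of_roomSeed_of_shedSeed
    hS
    (Summit.BirchSwinnertonDyer.BirchSwinnertonDyer.Theorems.KolyvaginAtTwo.KolyvaginSwap.shedSeedPrimeShapedAtTwo_of_frobeniusCongruence
      h37)
    h37

/-- **U1 from the two registered stubs** (the skeleton's closed form; its only sorries are the two stubs above). -/
theorem KolyvaginBoundedDefectAtTwo_of_stubs :
    Summit.BirchSwinnertonDyer.BirchSwinnertonDyer.Theses.KolyvaginRankRigidityAtTwo.KolyvaginBoundedDefectAtTwo :=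
  KolyvaginBoundedDefectAtTwo_of stub_roomSeedAtTwo stub_heegnerCongruence

end Summit.BirchSwinnertonDyer.BirchSwinnertonDyer.Cruxes.KolyvaginBoundedDefectAtTwo.KolyvaginSwap
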